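import Summits.HodgeConjecture.HodgeConjecture.Theorems.R90S10ArchSignKitDefs          -- ★ `phi3`, `GInf`, `archDeltaPP L μ := archExplicitTransferFactor L Φ₃ μ …`
import Literature.NumberTheory.Rogawski1990.ArchExplicitTransferFactorNondegenerate     -- ★ N2∞ (anisotropic guard) + `archEigenlineProjector_eq_vecMulVec_of_conj_eq`, ★ `…Regular` part 1
import Literature.NumberTheory.Automorphic.LocalUnitaryGroupCongr                       -- ★ `UnitaryGroup.antidiagOne_isHermitian`, `UnitaryGroup.isUnit_antidiagOne_det`
import HarnessLib

/-!
# R90-TF · S10 (Rogawski 1990 §13.8) · THEOREMS — `R90S10ArchDeltaPPNondegenerate`: PRINT'S ARCHIMEDEAN FACTOR `Δ″_∞` IS NON-DEGENERATE AT THE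
# QUASI-SPLIT FORM `Φ₃` — `IsArchNondegenerate L (phi3 L) (archDeltaPP L μ)` (T2's binder `hnd` ∕ conjunct (4) of ★ `realiseH₂_of_letters`' `hE`)

Cell hodgecm-mathlib, slab R90-TF, section S10 = §13.8, crux item h413 = stmt-HodgeConjecture-24833 (route `route-HodgeConjecture-HCCMUnconditional`).  Prover seat
K2E5-p16 (g9), DEAL #87 of the S10 dealer R90-C138-plan (g4) (2026-09-05T03:35:40Z): census-then-payer for the A ED. 10 sub-socket `sock_S10_archFamiliesJR6LE`
= ★ p864804 `hE` :88–:105; this file is the brick for its conjunct (4) `hnd` (census `K2/K2E5-p16/g9/CENSUS-DEAL87-JR6LE.md` d99cb92a7d9d47db).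

THE POINT.  ★ `Literature.NumberTheory.Rogawski1990.isArchNondegenerate_archExplicitTransferFactor` proves `Δ″_∞ ≠ 0` on the matching `G`-regular pairs for a
`c`-hermitian ANISOTROPIC `H′`; the quasi-split `Φ₃ = antidiag(1,1,1)` is isotropic (`e₀`), so that sentence does not apply at `archDeltaPP L μ = Δ″_∞(Φ₃)`.  But its
proof reads anisotropy at exactly one place — to get `det H′ ≠ 0` (the eigenline step «`vᴴ w(H′) = 0` with `v ≠ 0` contradicts `det w(H′) ≠ 0`») — and `det Φ₃ ≠ 0`
(★ `UnitaryGroup.isUnit_antidiagOne_det`).  This file re-runs ★'s §2–§3 with the hypothesis `hanis` REPLACED by `hdet : H′.det ≠ 0` (same mathematics, same tokens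
otherwise; the public ★ part-1 lemmas `archEigenlineProjector_eq_vecMulVec_of_conj_eq`, `evalC_eval_archCharpolyTwo_ne_zero_of_isArchGRegular`,
`conjTranspose_map_evalC_mul_form_mul`, `star_evalC_archGammaTwo_mul_self`, `archTau_ne_zero_of_isArchGRegular`, `archWeylRatio_ne_zero_of_isArchGRegular`,
`archMajoritySign_ne_zero` are used BY NAME), and specialises to `Φ₃`.

THE MATHEMATICS (Rogawski 1990 §4.9 pp. 54–55 «`|Δ_{G∕H}| = D_{G∕H}`»; §14.6 p. 242 «`κ(γ, ψ_v(iγ))` is equal to `±1`»; §3.6 pp. 28–29): on a matching pair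
`ι(γ_H) ↔ γ′` with `γ_H = (g, γ₂)` `G`-regular, `Δ″_∞ = τ(γ_H) · D_{G∕H,∞}(γ_H) · Π_w κ_w(γ_H, γ′)`, `τ ≠ 0`, `D ≠ 0` (★ part 1), and `κ_w ≠ 0`: with `γ′ = c ι(γ_H) c⁻¹`,
`P_w = v (s qᵀ)`, `v = c_w e₂`, `q = e₂ᵀ c_w⁻¹ ≠ 0`, `s = χ_{g_w}(γ₂,w) ≠ 0`, so `Re tr(P_wᴴ H P_w) = |s|²‖q‖² · Re(vᴴ H v)` with `H = w(H′)` hermitian, and `vᴴ H v ≠ 0`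
because `r := vᴴ H c_w` is a left `γ₂,w`-eigenvector of the pattern `ι_w` whose outer coordinates vanish (`χ_{g_w}(γ₂,w) ≠ 0`); were `r₁ = vᴴ H v = 0` then `vᴴ H = 0`
with `v ≠ 0`, contradicting `det w(H′) ≠ 0` — NON-DEGENERACY of the form, not anisotropy.

CONTENTS (theorems only; no `def`, no `instance`, no `notation`, no `sorry`; axioms ⊆ {propext, Classical.choice, Quot.sound}).
* `star_dotProduct_form_mulVec_ne_zero_of_conj_eq_of_det_ne_zero` — the eigenline is not `w(H′)`-isotropic, for `det H′ ≠ 0`.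
* `archKappaAt_ne_zero_of_det_ne_zero` — `κ_w(γ_H, γ′) ≠ 0` on a matching `G`-regular pair, for `c`-hermitian `H′` with `det H′ ≠ 0`.
* `isArchNondegenerate_archExplicitTransferFactor_of_det_ne_zero` — N2∞ for `c`-hermitian `H′` with `det H′ ≠ 0` (no hypothesis on `μ`).
* `isArchNondegenerate_archDeltaPP L μ : IsArchNondegenerate L (phi3 L) (archDeltaPP L μ)` — THE HEAD (T2's `hnd`; hE conjunct (4)).

HONEST LABEL: count-neutral helper (`--supports stmt-HodgeConjecture-24833`); pays no socket by itself (it removes `hnd` from the residual list of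
`sock_S10_archFamiliesJR6LE`; `h5` = Shelstad's quasi-split archimedean transfer stays a named letter).  HC_CM is proved only modulo the 7 printed citations
(2 remaining named inputs: hLiu418 = stmt-HodgeConjecture-24832, h413 = stmt-HodgeConjecture-24833) until rung 0 closes; REL ≠ ★ ≠ BUILT.
Namespace `Summit.HodgeConjecture.HodgeConjecture.R90.S10`.

## References
* [Rogawski1990] J. D. Rogawski, *Automorphic Representations of Unitary Groups in Three Variables*, Ann. of Math. Stud. 123 (1990): §3.6 pp. 28–29; §4.3 p. 42;
  §4.9 pp. 54–55; §14.3 p. 234; §14.6 p. 242.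
* [LanglandsShelstad1987] R. P. Langlands, D. Shelstad, *On the definition of transfer factors*, Math. Ann. 278 (1987), §1.
-/

set_option autoImplicit false
-- the mandated namespace repeats the single-problem summit's segment (`HodgeConjecture.HodgeConjecture`)
set_option linter.dupNamespace false

noncomputable section

open NumberField NumberField.InfinitePlace Matrix Polynomial
open Literature.NumberTheory.GaloisRepresentations
open Literature.NumberTheory.Automorphic Literature.NumberTheory.Rogawski1990
open Literature.AlgebraicGeometry.ShimuraVarieties (hermForm)
open scoped MatrixGroups ComplexOrder

namespace Summit.HodgeConjecture.HodgeConjecture.R90.S10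

/-! ## §1 The eigenline argument and `κ_w ≠ 0` for a NON-DEGENERATE (not necessarily anisotropic) form -/

section Place

variable (L : Type) [Field L] [NumberField L] [IsCMField L] (H' : Matrix (Fin 3) (Fin 3) L)
  (a : ↥(UnitaryGroup.arch (↥(maximalRealSubfield L)) L (IsCMField.complexConj L) 2
      (Matrix.of fun i j : Fin 2 => if i.val + j.val + 1 = 2 then (1 : L) else 0)) ×
    ↥(UnitaryGroup.arch (↥(maximalRealSubfield L)) L (IsCMField.complexConj L) 1
      (Matrix.of fun i j : Fin 1 => if i.val + j.val + 1 = 1 then (1 : L) else 0)))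
  (b : ↥(UnitaryGroup.arch (↥(maximalRealSubfield L)) L (IsCMField.complexConj L) 3 H'))
  (w : {w : InfinitePlace L // IsComplex w})

/-- **The distinguished eigenline is not `w(H′)`-isotropic, for `det H′ ≠ 0`**: for `γ′ = c ι(γ_H) c⁻¹` with `γ_H` `G`-regular, `vᴴ · w(H′) · v ≠ 0` for `v = c_w e₂`
(the `γ₂,w`-eigenvector of `γ′_w`) — by unitarity of `γ′_w`, `vᴴ w(H′) c_w` is a left `γ₂,w`-eigenvector of the pattern `ι_w`, whose outer coordinates vanish since
`χ_{g_w}(γ₂,w) ≠ 0`; so `vᴴ w(H′) v = 0` would force `vᴴ w(H′) = 0`, contradicting `det w(H′) ≠ 0` (★ `star_dotProduct_form_mulVec_ne_zero_of_conj_eq` with its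
anisotropy hypothesis weakened to the non-degeneracy it actually uses). [cite: Rogawski1990, §3.6 pp. 28–29; §14.6 p. 242] -/
theorem star_dotProduct_form_mulVec_ne_zero_of_conj_eq_of_det_ne_zero
    (hdet : H'.det ≠ 0) (hreg : IsArchGRegular L a)
    (c : GL (Fin 3) (mixedEmbedding.mixedSpace L))
    (hc : c * ((endoEmbArch L a : ↥(UnitaryGroup.arch (↥(maximalRealSubfield L)) L (IsCMField.complexConj L) 3
            (Matrix.of fun i j : Fin 3 => if i.val + j.val + 1 = 3 then (1 : L) else 0))) :
            GL (Fin 3) (mixedEmbedding.mixedSpace L)) * c⁻¹ = (b : GL (Fin 3) (mixedEmbedding.mixedSpace L))) :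
    star (fun i => UnitaryGroup.evalC L w ((c : Matrix (Fin 3) (Fin 3) (mixedEmbedding.mixedSpace L)) i 1)) ⬝ᵥ
        H'.map w.1.embedding *ᵥ (fun i => UnitaryGroup.evalC L w ((c : Matrix (Fin 3) (Fin 3) (mixedEmbedding.mixedSpace L)) i 1)) ≠ 0 := by
  -- notation
  set φ := UnitaryGroup.evalC L w with hφ
  set H := H'.map w.1.embedding with hH
  set cw := (c : Matrix (Fin 3) (Fin 3) (mixedEmbedding.mixedSpace L)).map φ with hcw
  set cw' := ((c⁻¹ : GL (Fin 3) (mixedEmbedding.mixedSpace L)) : Matrix (Fin 3) (Fin 3) (mixedEmbedding.mixedSpace L)).map φ with hcw'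
  set bw := ((b : GL (Fin 3) (mixedEmbedding.mixedSpace L)) : Matrix (Fin 3) (Fin 3) (mixedEmbedding.mixedSpace L)).map φ with hbw
  set g := (((a.1 : ↥(UnitaryGroup.arch (↥(maximalRealSubfield L)) L (IsCMField.complexConj L) 2
      (Matrix.of fun i j : Fin 2 => if i.val + j.val + 1 = 2 then (1 : L) else 0))) :
        GL (Fin 2) (mixedEmbedding.mixedSpace L)) : Matrix (Fin 2) (Fin 2) (mixedEmbedding.mixedSpace L)) with hg
  set u := (((a.2 : ↥(UnitaryGroup.arch (↥(maximalRealSubfield L)) L (IsCMField.complexConj L) 1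
      (Matrix.of fun i j : Fin 1 => if i.val + j.val + 1 = 1 then (1 : L) else 0))) :
        GL (Fin 1) (mixedEmbedding.mixedSpace L)) : Matrix (Fin 1) (Fin 1) (mixedEmbedding.mixedSpace L)) with hu
  set gw := g.map φ with hgw
  set uw := φ (u 0 0) with huw
  set v : Fin 3 → ℂ := fun i => UnitaryGroup.evalC L w ((c : Matrix (Fin 3) (Fin 3) (mixedEmbedding.mixedSpace L)) i 1) with hv
  have hvcw : v = fun i => cw i 1 := rfl
  -- invertibility of `c_w`
  have h1 : cw' * cw = 1 := by
    rw [hcw, hcw', ← Matrix.map_mul, ← Units.val_mul, inv_mul_cancel, Units.val_one, Matrix.map_one _ (map_zero φ) (map_one φ)]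
  have h2 : cw * cw' = 1 := by
    rw [hcw, hcw', ← Matrix.map_mul, ← Units.val_mul, mul_inv_cancel, Units.val_one, Matrix.map_one _ (map_zero φ) (map_one φ)]
  -- `γ′_w = c_w ι_w c_w⁻¹` with the explicit pattern
  set ιw : Matrix (Fin 3) (Fin 3) ℂ := !![gw 0 0, 0, gw 0 1; 0, uw, 0; gw 1 0, 0, gw 1 1] with hιw
  have hι : ((((endoEmbArch L a : ↥(UnitaryGroup.arch (↥(maximalRealSubfield L)) L (IsCMField.complexConj L) 3
            (Matrix.of fun i j : Fin 3 => if i.val + j.val + 1 = 3 then (1 : L) else 0))) :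
            GL (Fin 3) (mixedEmbedding.mixedSpace L)) : Matrix (Fin 3) (Fin 3) (mixedEmbedding.mixedSpace L))).map φ = ιw := by
    rw [coe_endoEmbArch, coe_endoGL_eq, hιw]
    ext i j
    fin_cases i <;> fin_cases j <;> simp [Matrix.map_apply, hgw, huw, hg, hu]
  have hbw' : bw = cw * ιw * cw' := by
    rw [hbw, ← hι, hcw, hcw', ← Matrix.map_mul, ← Matrix.map_mul, ← Units.val_mul, ← Units.val_mul, hc]
  have hbc : bw * cw = cw * ιw := by rw [hbw', Matrix.mul_assoc, h1, Matrix.mul_one]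
  -- `v` is the `γ₂,w`-eigenvector of `γ′_w`
  have hιe : ιw *ᵥ (Pi.single 1 (1 : ℂ)) = uw • Pi.single 1 (1 : ℂ) := by
    ext i
    fin_cases i <;> simp [hιw, Matrix.mulVec, dotProduct, Fin.sum_univ_three]
  have hve : cw *ᵥ Pi.single 1 (1 : ℂ) = v := by
    rw [Matrix.mulVec_single_one]
    rfl
  have hbv : bw *ᵥ v = uw • v := by
    rw [← hve, Matrix.mulVec_mulVec, hbc, ← Matrix.mulVec_mulVec, hιe, Matrix.mulVec_smul]
  -- unitarity of `γ′_w` and `|γ₂,w| = 1`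
  have hb : bwᴴ * H * bw = H := conjTranspose_map_evalC_mul_form_mul L H' b w
  have hu1 : starRingEnd ℂ uw * uw = 1 := star_evalC_archGammaTwo_mul_self L a w
  have hu1' : uw * star uw = 1 := by rw [Complex.star_def, mul_comm]; exact hu1
  -- Step A: `vᴴ H γ′_w = γ₂,w · vᴴ H`
  have hA : star v ᵥ* (H * bw) = uw • (star v ᵥ* H) := by
    have e1 : star v ᵥ* H = star v ᵥ* (bwᴴ * H * bw) := by rw [hb]
    rw [← Matrix.vecMul_vecMul, ← Matrix.vecMul_vecMul, ← Matrix.star_mulVec, hbv, star_smul, Matrix.smul_vecMul,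
      Matrix.smul_vecMul, Matrix.vecMul_vecMul] at e1
    rw [e1, smul_smul, hu1', one_smul]
  -- Step B: `r := vᴴ H c_w` is a left `γ₂,w`-eigenvector of the pattern
  set r : Fin 3 → ℂ := star v ᵥ* H ᵥ* cw with hr
  have hB : r ᵥ* ιw = uw • r := by
    rw [hr, Matrix.vecMul_vecMul, ← hbc, ← Matrix.vecMul_vecMul, Matrix.vecMul_vecMul (star v) H bw, hA, Matrix.smul_vecMul]
  -- Step C: the outer coordinates of `r` vanish
  have hB0 : r 0 * gw 0 0 + r 2 * gw 1 0 = uw * r 0 := by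
    have := congrFun hB 0
    simpa [hιw, Matrix.vecMul, dotProduct, Fin.sum_univ_three] using this
  have hB2 : r 0 * gw 0 1 + r 2 * gw 1 1 = uw * r 2 := by
    have := congrFun hB 2
    simpa [hιw, Matrix.vecMul, dotProduct, Fin.sum_univ_three] using this
  have hs : uw * uw - gw.trace * uw + gw.det ≠ 0 := by
    have h := evalC_eval_archCharpolyTwo_ne_zero_of_isArchGRegular L a w hreg
    rw [evalC_eval_archCharpolyTwo_archGammaTwo] at h
    exact h
  rw [Matrix.trace_fin_two, Matrix.det_fin_two] at hs
  have hr0 : r 0 = 0 := by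
    have h : (uw * uw - (gw 0 0 + gw 1 1) * uw + (gw 0 0 * gw 1 1 - gw 0 1 * gw 1 0)) * r 0 = 0 := by
      linear_combination (gw 1 1 - uw) * hB0 - gw 1 0 * hB2
    exact (mul_eq_zero.1 h).resolve_left hs
  have hr2 : r 2 = 0 := by
    have h : (uw * uw - (gw 0 0 + gw 1 1) * uw + (gw 0 0 * gw 1 1 - gw 0 1 * gw 1 0)) * r 2 = 0 := by
      linear_combination (gw 0 0 - uw) * hB2 - gw 0 1 * hB0
    exact (mul_eq_zero.1 h).resolve_left hs
  -- Step D: `r₁ = vᴴ H v`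
  have hr1 : r 1 = star v ⬝ᵥ H *ᵥ v := by
    rw [Matrix.dotProduct_mulVec]
    rfl
  -- Step E: `vᴴ H v = 0` would give `vᴴ H = 0`, contradicting `det w(H′) ≠ 0` and `v ≠ 0`
  intro hz
  have hr_zero : r = 0 := by
    funext i
    fin_cases i
    · exact hr0
    · exact hr1.trans hz
    · exact hr2
  have hvH : star v ᵥ* H = 0 := by
    have : star v ᵥ* H = r ᵥ* cw' := by
      rw [hr, Matrix.vecMul_vecMul, Matrix.vecMul_vecMul, h2, Matrix.mul_one]
    rw [this, hr_zero, Matrix.zero_vecMul]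
  have hdetH : H.det ≠ 0 := by
    rw [hH, ← RingHom.mapMatrix_apply, ← RingHom.map_det]
    exact (_root_.map_ne_zero _).2 hdet
  have hv0 : v ≠ 0 := by
    intro hv0
    have h11 := congrFun (congrFun h1 1) 1
    rw [Matrix.mul_apply, Matrix.one_apply_eq] at h11
    have hcol : ∀ j, cw j 1 = 0 := fun j => by
      have := congrFun hv0 j
      simpa [hvcw] using this
    simp [hcol] at h11
  have hsv0 : star v ≠ 0 := fun h => hv0 (star_eq_zero.1 h)
  exact hdetH (Matrix.exists_vecMul_eq_zero_iff.1 ⟨star v, hsv0, hvH⟩)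

/-- **`κ_w(γ_H, γ′) ≠ 0` on a matching `G`-regular pair** for `c`-hermitian `H′` with `det H′ ≠ 0` («`κ(γ, ψ_v(iγ)) = ±1`»): `Re tr(P_wᴴ w(H′) P_w) =
|χ_{g_w}(γ₂,w)|² · ‖e₂ᵀ c_w⁻¹‖² · vᴴ w(H′) v ≠ 0` (★ `archKappaAt_ne_zero` with anisotropy weakened to `det H′ ≠ 0`). [cite: Rogawski1990, §14.6 p. 242; §4.9 p. 55] -/
theorem archKappaAt_ne_zero_of_det_ne_zero (hherm : (H'.map (cmConjRingHom L)).transpose = H')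
    (hdet : H'.det ≠ 0) (hp : IsArchNormPair L H' a b) (hreg : IsArchGRegular L a) :
    archKappaAt L H' a w b ≠ 0 := by
  have hp' := hp
  rw [isArchNormPair_iff] at hp'
  obtain ⟨c, hc⟩ := isConj_iff.1 hp'
  set φ := UnitaryGroup.evalC L w with hφ
  set H := H'.map w.1.embedding with hH
  set v : Fin 3 → ℂ := fun i => φ ((c : Matrix (Fin 3) (Fin 3) (mixedEmbedding.mixedSpace L)) i 1) with hv
  set s : ℂ := φ ((archCharpolyTwo L a).eval (archGammaTwo L a)) with hsdef
  set q : Fin 3 → ℂ := fun j => s * φ (((c⁻¹ : GL (Fin 3) (mixedEmbedding.mixedSpace L)) : Matrix (Fin 3) (Fin 3) (mixedEmbedding.mixedSpace L)) 1 j)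
    with hq
  have hP : archEigenlineProjector L H' a w b = vecMulVec v q := archEigenlineProjector_eq_vecMulVec_of_conj_eq L H' a b w c hc
  have hs : s ≠ 0 := evalC_eval_archCharpolyTwo_ne_zero_of_isArchGRegular L a w hreg
  -- `z = vᴴ H v` is real and non-zero
  have hz : star v ⬝ᵥ H *ᵥ v ≠ 0 := star_dotProduct_form_mulVec_ne_zero_of_conj_eq_of_det_ne_zero L H' a b w hdet hreg c hc
  have hHh : Hᴴ = H := by
    have hcomp : (star : ℂ → ℂ) ∘ (w.1.embedding : L → ℂ) = (w.1.embedding : L → ℂ) ∘ (cmConjRingHom L : L → L) := by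
      funext x
      simp only [Function.comp_apply, embedding_cmConjRingHom, Complex.star_def]
    rw [hH, Matrix.conjTranspose, Matrix.transpose_map, Matrix.map_map, hcomp, ← Matrix.map_map, ← Matrix.transpose_map, hherm]
  have hzz : star (star v ⬝ᵥ H *ᵥ v) = star v ⬝ᵥ H *ᵥ v := by
    rw [← Matrix.star_dotProduct_star, star_star, Matrix.star_mulVec, hHh, ← Matrix.dotProduct_mulVec]
  have hzre : ((star v ⬝ᵥ H *ᵥ v).re : ℂ) = star v ⬝ᵥ H *ᵥ v := Complex.conj_eq_iff_re.1 (by rw [← Complex.star_def]; exact hzz)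
  have hzre0 : (star v ⬝ᵥ H *ᵥ v).re ≠ 0 := by
    intro h0
    apply hz
    rw [← hzre, h0, Complex.ofReal_zero]
  -- `q ≠ 0`: a row of the invertible `c_w⁻¹`, scaled by `s ≠ 0`
  have hq0 : q ≠ 0 := by
    set cw := (c : Matrix (Fin 3) (Fin 3) (mixedEmbedding.mixedSpace L)).map φ with hcw
    set cw' := ((c⁻¹ : GL (Fin 3) (mixedEmbedding.mixedSpace L)) : Matrix (Fin 3) (Fin 3) (mixedEmbedding.mixedSpace L)).map φ with hcw'
    have h1 : cw' * cw = 1 := by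
      rw [hcw, hcw', ← Matrix.map_mul, ← Units.val_mul, inv_mul_cancel, Units.val_one, Matrix.map_one _ (map_zero φ) (map_one φ)]
    intro hq0
    have h11 := congrFun (congrFun h1 1) 1
    rw [Matrix.mul_apply, Matrix.one_apply_eq] at h11
    have hrow : ∀ j, cw' 1 j = 0 := fun j => by
      have := congrFun hq0 j
      simp only [hq, Pi.zero_apply, mul_eq_zero] at this
      exact this.resolve_left hs
    simp [hrow] at h11
  -- `Σ |q_i|² ≠ 0` (as a real number) since `q ≠ 0`
  have hqq : star q ⬝ᵥ q = ((∑ i, Complex.normSq (q i) : ℝ) : ℂ) := by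
    rw [Complex.ofReal_sum]
    simp only [dotProduct, Pi.star_apply, Complex.star_def, Complex.normSq_eq_conj_mul_self]
  have hQ : (∑ i, Complex.normSq (q i)) ≠ 0 := by
    intro h
    apply hq0
    rw [← dotProduct_star_self_eq_zero, hqq, h, Complex.ofReal_zero]
  -- the rank-one trace: `tr((v qᵀ)ᴴ H (v qᵀ)) = (q^† q) · (v^† H v)`
  have htr : ((vecMulVec v q)ᴴ * H * vecMulVec v q).trace = (star q ⬝ᵥ q) * (star v ⬝ᵥ H *ᵥ v) := by
    rw [conjTranspose_vecMulVec, vecMulVec_mul, vecMulVec_mul_vecMulVec, trace_vecMulVec, dotProduct_smul, ← dotProduct_mulVec,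
      smul_eq_mul, mul_comm]
  -- the sign of a non-zero real, cast to `ℤ`, is non-zero
  have hsign : ∀ {x : ℝ}, x ≠ 0 → ((SignType.sign x : SignType) : ℤ) ≠ 0 := by
    intro x hx
    rcases lt_trichotomy x 0 with h | h | h
    · rw [sign_neg h]; decide
    · exact absurd h hx
    · rw [sign_pos h]; decide
  -- assemble
  unfold archKappaAt
  rw [hP, htr, hqq, Complex.re_ofReal_mul]
  exact mul_ne_zero (hsign (mul_ne_zero hQ hzre0)) (archMajoritySign_ne_zero L H' w)

end Place

/-! ## §2 Assembly: `Δ″_∞(H′)` is non-degenerate for `det H′ ≠ 0`; the head at `Φ₃` -/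

section Main

variable (L : Type) [Field L] [NumberField L] [IsCMField L] (H' : Matrix (Fin 3) (Fin 3) L) (μ : HeckeCharacter L)
  (hl : ∀ (a : ↥(UnitaryGroup.arch (↥(maximalRealSubfield L)) L (IsCMField.complexConj L) 2
          (Matrix.of fun i j : Fin 2 => if i.val + j.val + 1 = 2 then (1 : L) else 0)) ×
        ↥(UnitaryGroup.arch (↥(maximalRealSubfield L)) L (IsCMField.complexConj L) 1
          (Matrix.of fun i j : Fin 1 => if i.val + j.val + 1 = 1 then (1 : L) else 0)))
      (b : ↥(UnitaryGroup.arch (↥(maximalRealSubfield L)) L (IsCMField.complexConj L) 3 H'))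
      (x : ↥(UnitaryGroup.arch (↥(maximalRealSubfield L)) L (IsCMField.complexConj L) 2
          (Matrix.of fun i j : Fin 2 => if i.val + j.val + 1 = 2 then (1 : L) else 0)) ×
        ↥(UnitaryGroup.arch (↥(maximalRealSubfield L)) L (IsCMField.complexConj L) 1
          (Matrix.of fun i j : Fin 1 => if i.val + j.val + 1 = 1 then (1 : L) else 0))),
      archExplicitDelta L H' (x * a * x⁻¹) μ b = archExplicitDelta L H' a μ b)
  (hr : ∀ (a : ↥(UnitaryGroup.arch (↥(maximalRealSubfield L)) L (IsCMField.complexConj L) 2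
          (Matrix.of fun i j : Fin 2 => if i.val + j.val + 1 = 2 then (1 : L) else 0)) ×
        ↥(UnitaryGroup.arch (↥(maximalRealSubfield L)) L (IsCMField.complexConj L) 1
          (Matrix.of fun i j : Fin 1 => if i.val + j.val + 1 = 1 then (1 : L) else 0)))
      (b y : ↥(UnitaryGroup.arch (↥(maximalRealSubfield L)) L (IsCMField.complexConj L) 3 H')),
      archExplicitDelta L H' a μ (y * b * y⁻¹) = archExplicitDelta L H' a μ b)

open scoped Classical in
/-- **N2∞ for a NON-DEGENERATE `c`-hermitian form**: `Δ″_∞(γ_H, γ′) ≠ 0` whenever `ι(γ_H) ↔ γ′` and `γ_H` is `G`-regular, for `H′` `c`-hermitian with `det H′ ≠ 0`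
(★ `isArchNondegenerate_archExplicitTransferFactor` with anisotropy weakened to `det H′ ≠ 0`; no hypothesis on `μ`).
[cite: Rogawski1990, §4.9 pp. 54–55; §14.6 p. 242] [cite: LanglandsShelstad1987, §1] -/
theorem isArchNondegenerate_archExplicitTransferFactor_of_det_ne_zero (hherm : (H'.map (cmConjRingHom L)).transpose = H') (hdet : H'.det ≠ 0) :
    IsArchNondegenerate L H' (archExplicitTransferFactor L H' μ hl hr) := by
  rw [isArchNondegenerate_iff]
  intro γH γ hp hreg
  rw [archExplicitTransferFactor_Δ, archExplicitDelta_of_isArchNormPair L H' γH μ hp]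
  refine mul_ne_zero (mul_ne_zero (archTau_ne_zero_of_isArchGRegular L γH μ hreg)
    (Complex.ofReal_ne_zero.2 (archWeylRatio_ne_zero_of_isArchGRegular L γH hreg))) ?_
  rw [Int.cast_ne_zero]
  exact Finset.prod_ne_zero_iff.2 fun w _ => archKappaAt_ne_zero_of_det_ne_zero L H' γH γ w hherm hdet hp hreg

open scoped Classical in
/-- **PRINT'S FACTOR `Δ″_∞` IS NON-DEGENERATE AT THE QUASI-SPLIT FORM `Φ₃`** — T2's binder `hnd` ∕ conjunct (4) of ★ `realiseH₂_of_letters`' `hE`, for EVERY Hecke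
character `μ`: `IsArchNondegenerate L (phi3 L) (archDeltaPP L μ)`.  `Φ₃` is `c`-hermitian (★ `UnitaryGroup.antidiagOne_isHermitian`) with `det Φ₃` a unit (★
`UnitaryGroup.isUnit_antidiagOne_det`); `archDeltaPP L μ` is the reducible abbreviation `archExplicitTransferFactor L Φ₃ μ (archExplicitDelta_conj_left …)
(archExplicitDelta_conj_right …)`. [cite: Rogawski1990, §4.9 pp. 54–55; §14.3 p. 234; §14.6 p. 242] [cite: LanglandsShelstad1987, §1] -/
theorem isArchNondegenerate_archDeltaPP : IsArchNondegenerate L (phi3 L) (archDeltaPP L μ) :=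
  isArchNondegenerate_archExplicitTransferFactor_of_det_ne_zero L (phi3 L) μ (archExplicitDelta_conj_left L (phi3 L) μ)
    (archExplicitDelta_conj_right L (phi3 L) μ) (UnitaryGroup.antidiagOne_isHermitian L 3) (UnitaryGroup.isUnit_antidiagOne_det L 3).ne_zero

end Main

end Summit.HodgeConjecture.HodgeConjecture.R90.S10

end
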